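import Summits.QuantumFields.YangMills.Theorems.FluctuationComparisonRegPrIntLS2BetaBodyDoorThm2Moved
import HarnessLib

/-!
# S2β · GAP♯∘ — «THE LIFT-INDEPENDENT TRIPLE DOOR» (REBASE-U₀ + the triple move for ANY lift `û` with prescribed descent `û↓ = t`): the stratum gap body at
# `(t•V, û•U₀, û•U)` ⟺ the body at `(V, U₀, U)` — so a SMOOTH (Lipschitz) lift may replace the block-constant `liftTransfTo t` without touching the GAP♯∘ side

Cell `ym3-torus` (rung R3 = continuum `SU(2)` YM₃ on T³ at fixed lattice data — NOT d = 4, NOT infinite volume, NOT a mass gap, NOT Clay).  Width seat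
`ym3-torus-px16` (gen 24); crux `stmt-QuantumFields-20520`, LINE g18-1 S2β (registry untouched); organ GAP♯∘; (RES-u) of record (architect px17 g23, desk №704).
px21 g26's COUNT «E_J-FACE» (2026-09-01T01:57Z): the block-constant lift `ǔ = liftTransfTo t` puts `O(window)` jumps on the top-block FACES of the moved background;
exit (a) «SMOOTH LIFT» replaces it by a Lipschitz `û` with the same descent `û↓ = t`, and «(RES-u.3) admissibility is lift-independent».  THIS FILE makes that
sentence kernel: §1 REBASE-U₀ — the residual-orbit infimum and the argmin membership are unchanged under a RESIDUAL re-gauging of the MINIMISER `U₀ ↦ r•U₀`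
(`w ↦ w·r`; ✓`residual_mul`, ✓`gaugeAct_mem_argmin_iff_of_residual`); §2 ★★`body_triple_iff_of_descTransf_eq (hε₀) (hû : descTransf û = t)`:
BODY(`t•V, û•U₀, û•U`) ↔ BODY(`V, U₀, U`) for ANY `û` over `t` — split `û = (liftTransfTo t)·r′`, `r′` residual (✓p839687 `residual_liftDesc_inv_mul`), then
✓p839644 `body_triple_iff` for `liftTransfTo t`, §1 for `r′` on the minimiser and ✓p839557 `body_gaugeAct_residual_iff` for `r′` on the fine field; §3 admissibility
of the `û`-moved triple (`û•U ∈ fibre(t•V)`, `û•U₀ ∈ argmin-set(t•V)`).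
`--kind proof --supports stmt-QuantumFields-20520 --as helper`, count-neutral, DEFINITION-FREE (0 `def`, 0 `instance`, 0 `sorry`; default heartbeats).

HONEST.  Gauge-covariance plumbing over landed doors; the smooth lift's EXISTENCE ∕ Lipschitz letter is w5∕px21's, NOT here; the B7 dictionary, (REG-UP), (L2-TOWER),
(JNC-E), hsupp, hD, hDBX are OPEN ∕ HYPOTHESES elsewhere; nothing of Bałaban's analysis asserted ([Balaban1985Variational] p.278, Thm 1 (8)–(10) p.279; [Balaban1985Averaging]
(8), (11)–(13) pp.18–19); GAP♯∘ (`stub_uniformFibreGapOrbit`, 0∕5), the five REGISTERED stubs, S2β, crux 20520, 19936, 19200, `YM3TorusSU2` NOT proved; rung R3 = SU(2)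
YM₃ on T³ — NOT d = 4, NOT infinite volume, NOT a mass gap, NOT Clay; the Yang–Mills mass gap is NOT proved.
-/

set_option autoImplicit false

noncomputable section

namespace Summit.QuantumFields.YangMills.Theorems.FluctuationComparisonRegPrIntLS2BetaBodyRebaseLift

open Finset
open Literature.MathematicalPhysics.QuantumFieldTheory.Balaban1983to89
open T4Continuum T3ContinuumYM3Torus T3UnitScaleTilt T3TiltDescent T3LevelShift
open T3UnitLawDensityEML (ℰp)
open T3ConstrainedMinimiser (fibre)
open T3PrintedRegularMinimiser (minActionRegPr)
open T3PrintedRegularOrbits (liftTransfTo descTransf descTransf_liftTransfTo descendTo_gaugeAct gaugeAct_mem_fibre_iff)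
open Summit.QuantumFields.YangMills.Theorems.FluctuationComparisonRegPrIntLS2BetaResidualGauge
  (gaugeAct_mul_eq residual_one residual_mul residual_inv gaugeAct_mem_histGood_iff gaugeAct_mem_argmin_iff_of_residual)
open Summit.QuantumFields.YangMills.Theorems.FluctuationComparisonRegPrIntLS2BetaOrbitDistComparison (iInf_orbitDistSq_le_of_residual)
open Summit.QuantumFields.YangMills.Theorems.FluctuationComparisonRegPrIntLS2BetaDatumGaugeWLOG (mem_argmin_gaugeAct_liftTransfTo)
open Summit.QuantumFields.YangMills.Theorems.FluctuationComparisonRegPrIntLS2BetaBodyRebaseResidual (body_gaugeAct_residual_iff)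
open Summit.QuantumFields.YangMills.Theorems.FluctuationComparisonRegPrIntLS2BetaBodyRebaseTriple (body_triple_iff)
open Summit.QuantumFields.YangMills.Theorems.FluctuationComparisonRegPrIntLS2BetaThm2GaugeSplitResidual (residual_liftDesc_inv_mul)

variable (F : T3Family) {J K : ℕ} (hJK : J ≤ K)

/-! ## §1 REBASE-U₀: a residual re-gauging of the minimiser -/

/-- ★ **`⨅_{w residual} d²(U, w•(r•U₀)) = ⨅_{w residual} d²(U, w•U₀)` for residual `r`** (`w•(r•U₀) = (w·r)•U₀`, ✓`gaugeAct_mul_eq`; re-index by `w ↦ w·r` ∕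
`w ↦ w·r⁻¹`, ✓`residual_mul`∕✓`residual_inv`). [cite: Balaban1985Variational, Thm 1 (8)-(10) p.279; Balaban1987RG1, p.256] -/
theorem iInf_orbitDistSq_gaugeAct_residual_bkg {r : Site (F.P K) 0 → Matrix.specialUnitaryGroup (Fin 2) ℂ}
    (hr : ∀ U : GaugeField (F.P K) 0 (Matrix.specialUnitaryGroup (Fin 2) ℂ),
      descendTo F ℰp J K hJK (GaugeField.gaugeAct r U) = descendTo F ℰp J K hJK U)
    (U U₀ : GaugeField (F.P K) 0 (Matrix.specialUnitaryGroup (Fin 2) ℂ)) :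
    (⨅ w : {w : GaugeTransf (F.P K) 0 (Matrix.specialUnitaryGroup (Fin 2) ℂ) | ∀ U : GaugeField (F.P K) 0 (Matrix.specialUnitaryGroup (Fin 2) ℂ),
              descendTo F ℰp J K hJK (GaugeField.gaugeAct w U) = descendTo F ℰp J K hJK U}, ∑ ℓ : PBond (F.P K) 0,
            dist1 ((U) ℓ *
              ((GaugeField.gaugeAct (w : GaugeTransf (F.P K) 0 (Matrix.specialUnitaryGroup (Fin 2) ℂ)) (GaugeField.gaugeAct r U₀)) ℓ)⁻¹) ^ 2) =
      (⨅ w : {w : GaugeTransf (F.P K) 0 (Matrix.specialUnitaryGroup (Fin 2) ℂ) | ∀ U : GaugeField (F.P K) 0 (Matrix.specialUnitaryGroup (Fin 2) ℂ),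
              descendTo F ℰp J K hJK (GaugeField.gaugeAct w U) = descendTo F ℰp J K hJK U}, ∑ ℓ : PBond (F.P K) 0,
            dist1 ((U) ℓ *
              ((GaugeField.gaugeAct (w : GaugeTransf (F.P K) 0 (Matrix.specialUnitaryGroup (Fin 2) ℂ)) (U₀)) ℓ)⁻¹) ^ 2) := by
  haveI : Nonempty {w : GaugeTransf (F.P K) 0 (Matrix.specialUnitaryGroup (Fin 2) ℂ) | ∀ U : GaugeField (F.P K) 0 (Matrix.specialUnitaryGroup (Fin 2) ℂ),
              descendTo F ℰp J K hJK (GaugeField.gaugeAct w U) = descendTo F ℰp J K hJK U} := ⟨⟨fun _ => 1, residual_one F hJK⟩⟩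
  have hr' := residual_inv F hJK hr
  apply le_antisymm
  · refine le_ciInf fun w => ?_
    have hw := residual_mul F hJK w.2 hr'
    refine (iInf_orbitDistSq_le_of_residual F hJK U (GaugeField.gaugeAct r U₀) hw).trans (le_of_eq ?_)
    rw [← gaugeAct_mul_eq, mul_assoc, inv_mul_cancel, mul_one]
  · refine le_ciInf fun w => ?_
    have hw := residual_mul F hJK w.2 hr
    refine (iInf_orbitDistSq_le_of_residual F hJK U U₀ hw).trans (le_of_eq ?_)
    rw [← gaugeAct_mul_eq]

/-- ★ **REBASE-U₀ BODY DOOR**: for residual `r`, BODY(`V, r•U₀, U`) ↔ BODY(`V, U₀, U`); the minimiser's admissibility by ✓`gaugeAct_mem_argmin_iff_of_residual`.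
[cite: Balaban1985Variational, Thm 1 (8)-(10) p.279] -/
theorem body_gaugeAct_residual_bkg_iff {r : Site (F.P K) 0 → Matrix.specialUnitaryGroup (Fin 2) ℂ}
    (hr : ∀ U : GaugeField (F.P K) 0 (Matrix.specialUnitaryGroup (Fin 2) ℂ),
      descendTo F ℰp J K hJK (GaugeField.gaugeAct r U) = descendTo F ℰp J K hJK U)
    (μ ε₀ : ℝ) (V : GaugeField (F.P J) 0 (Matrix.specialUnitaryGroup (Fin 2) ℂ)) (U₀ U : GaugeField (F.P K) 0 (Matrix.specialUnitaryGroup (Fin 2) ℂ)) :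
    (μ * ((F.L : ℝ)⁻¹) ^ (2 * (K - J)) *
          (⨅ w : {w : GaugeTransf (F.P K) 0 (Matrix.specialUnitaryGroup (Fin 2) ℂ) | ∀ U : GaugeField (F.P K) 0 (Matrix.specialUnitaryGroup (Fin 2) ℂ),
              descendTo F ℰp J K hJK (GaugeField.gaugeAct w U) = descendTo F ℰp J K hJK U}, ∑ ℓ : PBond (F.P K) 0,
            dist1 ((U) ℓ *
              ((GaugeField.gaugeAct (w : GaugeTransf (F.P K) 0 (Matrix.specialUnitaryGroup (Fin 2) ℂ)) (GaugeField.gaugeAct r U₀)) ℓ)⁻¹) ^ 2)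
        ≤ wilsonAction4 (U) - minActionRegPr F J K hJK ε₀ (V)) ↔
      (μ * ((F.L : ℝ)⁻¹) ^ (2 * (K - J)) *
          (⨅ w : {w : GaugeTransf (F.P K) 0 (Matrix.specialUnitaryGroup (Fin 2) ℂ) | ∀ U : GaugeField (F.P K) 0 (Matrix.specialUnitaryGroup (Fin 2) ℂ),
              descendTo F ℰp J K hJK (GaugeField.gaugeAct w U) = descendTo F ℰp J K hJK U}, ∑ ℓ : PBond (F.P K) 0,
            dist1 ((U) ℓ *
              ((GaugeField.gaugeAct (w : GaugeTransf (F.P K) 0 (Matrix.specialUnitaryGroup (Fin 2) ℂ)) (U₀)) ℓ)⁻¹) ^ 2)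
        ≤ wilsonAction4 (U) - minActionRegPr F J K hJK ε₀ (V)) := by
  rw [iInf_orbitDistSq_gaugeAct_residual_bkg F hJK hr U U₀]

/-! ## §2 The lift-independent triple door -/

/-- `û = (liftTransfTo (û↓))·r′` with `r′ := (liftTransfTo (û↓))⁻¹·û` — as an action: `û•X = (liftTransfTo t)•(r′•X)` when `û↓ = t`. [cite: Balaban1985Averaging, (8), (12) pp.18-19] -/
theorem gaugeAct_lift_eq (û : Site (F.P K) 0 → Matrix.specialUnitaryGroup (Fin 2) ℂ) {t : Site (F.P J) 0 → Matrix.specialUnitaryGroup (Fin 2) ℂ} (hû : descTransf F J K hJK û = t)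
    (X : GaugeField (F.P K) 0 (Matrix.specialUnitaryGroup (Fin 2) ℂ)) :
    GaugeField.gaugeAct û X =
      GaugeField.gaugeAct (liftTransfTo F J K hJK t)
        (GaugeField.gaugeAct (fun x => (liftTransfTo F J K hJK (descTransf F J K hJK û) x)⁻¹ * û x) X) := by
  rw [← gaugeAct_mul_eq, ← hû]
  congr 1
  funext x
  rw [Pi.mul_apply, mul_inv_cancel_left]

/-- ★★ **THE LIFT-INDEPENDENT TRIPLE DOOR**: for ANY fine gauge transformation `û` whose descent is `t` and `ε₀ ≥ 0`, the GAP♯∘ body (✓p838507's conclusion tail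
VERBATIM) at `(t•V, û•U₀, û•U)` ⟺ at `(V, U₀, U)`.  (Block-constant lift: ✓`body_triple_iff`; a smooth lift for «E_J-FACE» exit (a): this.) [cite: Balaban1985Variational, p.278, Thm 1 (8)-(10) p.279] -/
theorem body_triple_iff_of_descTransf_eq {ε₀ : ℝ} (hε₀ : 0 ≤ ε₀) (û : Site (F.P K) 0 → Matrix.specialUnitaryGroup (Fin 2) ℂ) {t : Site (F.P J) 0 → Matrix.specialUnitaryGroup (Fin 2) ℂ}
    (hû : descTransf F J K hJK û = t) (μ : ℝ)
    (V : GaugeField (F.P J) 0 (Matrix.specialUnitaryGroup (Fin 2) ℂ)) (U₀ U : GaugeField (F.P K) 0 (Matrix.specialUnitaryGroup (Fin 2) ℂ)) :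
    (μ * ((F.L : ℝ)⁻¹) ^ (2 * (K - J)) *
          (⨅ w : {w : GaugeTransf (F.P K) 0 (Matrix.specialUnitaryGroup (Fin 2) ℂ) | ∀ U : GaugeField (F.P K) 0 (Matrix.specialUnitaryGroup (Fin 2) ℂ),
              descendTo F ℰp J K hJK (GaugeField.gaugeAct w U) = descendTo F ℰp J K hJK U}, ∑ ℓ : PBond (F.P K) 0,
            dist1 ((GaugeField.gaugeAct û U) ℓ *
              ((GaugeField.gaugeAct (w : GaugeTransf (F.P K) 0 (Matrix.specialUnitaryGroup (Fin 2) ℂ)) (GaugeField.gaugeAct û U₀)) ℓ)⁻¹) ^ 2)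
        ≤ wilsonAction4 (GaugeField.gaugeAct û U) - minActionRegPr F J K hJK ε₀ (GaugeField.gaugeAct t V)) ↔
      (μ * ((F.L : ℝ)⁻¹) ^ (2 * (K - J)) *
          (⨅ w : {w : GaugeTransf (F.P K) 0 (Matrix.specialUnitaryGroup (Fin 2) ℂ) | ∀ U : GaugeField (F.P K) 0 (Matrix.specialUnitaryGroup (Fin 2) ℂ),
              descendTo F ℰp J K hJK (GaugeField.gaugeAct w U) = descendTo F ℰp J K hJK U}, ∑ ℓ : PBond (F.P K) 0,
            dist1 ((U) ℓ *
              ((GaugeField.gaugeAct (w : GaugeTransf (F.P K) 0 (Matrix.specialUnitaryGroup (Fin 2) ℂ)) (U₀)) ℓ)⁻¹) ^ 2)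
        ≤ wilsonAction4 (U) - minActionRegPr F J K hJK ε₀ (V)) := by
  have hr := residual_liftDesc_inv_mul F hJK û
  rw [gaugeAct_lift_eq F hJK û hû U₀, gaugeAct_lift_eq F hJK û hû U, body_triple_iff F hJK hε₀ t μ V,
    body_gaugeAct_residual_bkg_iff F hJK hr, body_gaugeAct_residual_iff F hJK hr]

/-- USE FORM. [cite: Balaban1985Variational, Thm 1 (8)-(10) p.279] -/
theorem body_of_body_triple_of_descTransf_eq {ε₀ : ℝ} (hε₀ : 0 ≤ ε₀) (û : Site (F.P K) 0 → Matrix.specialUnitaryGroup (Fin 2) ℂ) {t : Site (F.P J) 0 → Matrix.specialUnitaryGroup (Fin 2) ℂ}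
    (hû : descTransf F J K hJK û = t) {μ : ℝ}
    {V : GaugeField (F.P J) 0 (Matrix.specialUnitaryGroup (Fin 2) ℂ)} {U₀ U : GaugeField (F.P K) 0 (Matrix.specialUnitaryGroup (Fin 2) ℂ)}
    (h : (μ * ((F.L : ℝ)⁻¹) ^ (2 * (K - J)) *
          (⨅ w : {w : GaugeTransf (F.P K) 0 (Matrix.specialUnitaryGroup (Fin 2) ℂ) | ∀ U : GaugeField (F.P K) 0 (Matrix.specialUnitaryGroup (Fin 2) ℂ),
              descendTo F ℰp J K hJK (GaugeField.gaugeAct w U) = descendTo F ℰp J K hJK U}, ∑ ℓ : PBond (F.P K) 0,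
            dist1 ((GaugeField.gaugeAct û U) ℓ *
              ((GaugeField.gaugeAct (w : GaugeTransf (F.P K) 0 (Matrix.specialUnitaryGroup (Fin 2) ℂ)) (GaugeField.gaugeAct û U₀)) ℓ)⁻¹) ^ 2)
        ≤ wilsonAction4 (GaugeField.gaugeAct û U) - minActionRegPr F J K hJK ε₀ (GaugeField.gaugeAct t V))) :
    (μ * ((F.L : ℝ)⁻¹) ^ (2 * (K - J)) *
          (⨅ w : {w : GaugeTransf (F.P K) 0 (Matrix.specialUnitaryGroup (Fin 2) ℂ) | ∀ U : GaugeField (F.P K) 0 (Matrix.specialUnitaryGroup (Fin 2) ℂ),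
              descendTo F ℰp J K hJK (GaugeField.gaugeAct w U) = descendTo F ℰp J K hJK U}, ∑ ℓ : PBond (F.P K) 0,
            dist1 ((U) ℓ *
              ((GaugeField.gaugeAct (w : GaugeTransf (F.P K) 0 (Matrix.specialUnitaryGroup (Fin 2) ℂ)) (U₀)) ℓ)⁻¹) ^ 2)
        ≤ wilsonAction4 (U) - minActionRegPr F J K hJK ε₀ (V)) :=
  (body_triple_iff_of_descTransf_eq F hJK hε₀ û hû μ V U₀ U).mp h

/-! ## §3 Admissibility of the `û`-moved triple -/

/-- `û•U ∈ fibre(t•V)` when `U ∈ fibre(V)` and `û↓ = t`. [cite: Balaban1985Averaging, (11)-(13) p.19] -/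
theorem gaugeAct_lift_mem_fibre (û : Site (F.P K) 0 → Matrix.specialUnitaryGroup (Fin 2) ℂ) {t : Site (F.P J) 0 → Matrix.specialUnitaryGroup (Fin 2) ℂ} (hû : descTransf F J K hJK û = t)
    {U : GaugeField (F.P K) 0 (Matrix.specialUnitaryGroup (Fin 2) ℂ)} {V : GaugeField (F.P J) 0 (Matrix.specialUnitaryGroup (Fin 2) ℂ)} (hU : U ∈ fibre F ℰp J K hJK V) :
    GaugeField.gaugeAct û U ∈ fibre F ℰp J K hJK (GaugeField.gaugeAct t V) := by
  have h := (gaugeAct_mem_fibre_iff F hJK ℰp û U V).mpr hU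
  rwa [hû] at h

/-- `û•U₀ ∈ argmin-set(t•V)` (set text as in GAP♯∘) when `U₀ ∈ argmin-set(V)` and `û↓ = t`. [cite: Balaban1985Variational, Thm 1 p.279, (3)-(4) p.278] -/
theorem gaugeAct_lift_mem_argmin {γ b₀ p₀ ε₀ : ℝ} (hε₀ : 0 ≤ ε₀) (û : Site (F.P K) 0 → Matrix.specialUnitaryGroup (Fin 2) ℂ) {t : Site (F.P J) 0 → Matrix.specialUnitaryGroup (Fin 2) ℂ}
    (hû : descTransf F J K hJK û = t) (V : GaugeField (F.P J) 0 (Matrix.specialUnitaryGroup (Fin 2) ℂ)) {U₀ : GaugeField (F.P K) 0 (Matrix.specialUnitaryGroup (Fin 2) ℂ)}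
    (hU₀ : U₀ ∈ {U' : GaugeField (F.P K) 0 (Matrix.specialUnitaryGroup (Fin 2) ℂ) | U' ∈ fibre F ℰp J K hJK V ∧ U' ∈ histGood F ℰp (θBal F.L γ b₀ p₀) K J ∧
      wilsonAction4 U' = minActionRegPr F J K hJK ε₀ V}) :
    GaugeField.gaugeAct û U₀ ∈ {U' : GaugeField (F.P K) 0 (Matrix.specialUnitaryGroup (Fin 2) ℂ) |
      U' ∈ fibre F ℰp J K hJK (GaugeField.gaugeAct t V) ∧ U' ∈ histGood F ℰp (θBal F.L γ b₀ p₀) K J ∧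
      wilsonAction4 U' = minActionRegPr F J K hJK ε₀ (GaugeField.gaugeAct t V)} := by
  have hr := residual_liftDesc_inv_mul F hJK û
  rw [gaugeAct_lift_eq F hJK û hû U₀]
  exact mem_argmin_gaugeAct_liftTransfTo F hJK hε₀ t V ((gaugeAct_mem_argmin_iff_of_residual F hJK hr U₀ V).mpr hU₀)

end Summit.QuantumFields.YangMills.Theorems.FluctuationComparisonRegPrIntLS2BetaBodyRebaseLift

end
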